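import Literature.MathematicalPhysics.QuantumFieldTheory.ConformalBootstrap3D.PointKernelUnbounded
import Literature.MathematicalPhysics.QuantumFieldTheory.ConformalBootstrap3D.PointCertificateTableScover

/-!
# The kernel certificate theorem with `s`-covered head cells (piece certificates)

`PCert.boxExcluded_of_kernelC_unbounded` (PointKernelUnbounded) consumes, per head cell, the fact
`PCert.CellFact` = "the cell's table number on the FULL `s`-width `[slo, shi]` is `≥ 0`".  Near the
LP-active points of a frontier certificate that number is negative while the numbers on narrow
`s`-pieces are positive (pub-ising3d TABLECHECK R6/F10; the table-level mixed-width theorems are in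
`PointCertificateTableScover`).  This file lets a kernel instance use `s`-pieces for individual cells
WITHOUT touching the kernel's checkers:

* `PCert.CellFactS` — the weaker per-cell fact "some monotone partition
  `slo = σ_0 ≤ ⋯ ≤ σ_P = shi` has the cell's number `≥ 0` on every piece" (`CellFact.toS`: `P = 1`);
* `boxExcluded_of_pointTable_twist_unboundedS` — the one-bit unbounded table theorem with the head
  hypothesis in that existential per-cell form (via `cell_of_headNumber₂_scover`);
* `PCert.boxExcluded_of_kernelC_unboundedS` — the kernel certificate theorem with `hcells` weakened to
  `CellFactS`;
* PIECE CERTIFICATES: `PCert.withS c slo' shi' a b d` is `c` with the `s`-box replaced by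
  `[slo', shi']` (atom indices `a, b, d` for `slo', shi', shi' - slo'` in the SAME atom tables), so
  every existing checker (`hPartSideOK`/`hPartOK`/`hParts_sound`, `hBlockOK`) runs unchanged on it;
  `checkNodes_withS` transfers the node checks, `CellFact_withS` reads a piece certificate's cell fact
  as the number on `[slo', shi']`, and `CellFactS_of_pieces` assembles the pieces.

[cite: HogervorstRychkov2013, §3 eq. (3.6)]
-/

noncomputable section

namespace Literature.MathematicalPhysics.QuantumFieldTheory.ConformalBootstrap3D

open Literature.Analysis.ValidatedNumerics (rall)
open Real Finset Set

/-! ### The one-bit unbounded table theorem, head numbers per `s`-piece -/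

/-- **One-bit table, twist-gap domain, identity direct, unbounded `Δ_ε`-range, `s`-covered head
cells.** As `boxExcluded_of_pointTable_twist_unboundedI`, but head cell `(ℓ, k)` is certified by SOME
monotone partition `s_lo = σ_0 ≤ ⋯ ≤ σ_P = s_hi` (`P ≥ 1`) with `headNumber ≥ 0` on every piece.
[cite: HogervorstRychkov2013, §3 eq. (3.6)] -/
theorem boxExcluded_of_pointTable_twist_unboundedS {N : ℕ} {w z zb : Fin N → ℝ}
    (hz : ∀ k, z k ∈ Ioo (0 : ℝ) 1) (hzb : ∀ k, zb k ∈ Ioo (0 : ℝ) 1) (hord : ∀ k, zb k ≤ z k)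
    (apex : Fin N) (hapex : 0 ≤ w apex) (qd qr : Fin N → ℝ) (hqd : ∀ k, 0 < qd k ∧ qd k ≤ 1)
    (hqr : ∀ k, 0 < qr k ∧ qr k ≤ 1)
    (hdomd : ∀ k, z k * zb k ≤ qd k ^ 2 * (z apex * zb apex) ∧ z k ≤ qd k * z apex)
    (hdomr : ∀ k, (1 - z k) * (1 - zb k) ≤ qr k ^ 2 * (z apex * zb apex) ∧
      1 - zb k ≤ qr k * z apex)
    {Q : Set (ℝ × ℝ)} {slo shi εlo E₀ ET τ : ℝ}
    (hQ : ∀ p ∈ Q, (slo ≤ p.1 ∧ p.1 ≤ shi) ∧ εlo ≤ p.2)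
    (hε3 : εlo ≤ 3) (L : ℕ) (hL : E₀ ≤ (L : ℝ) + 1) (hτ1 : τ ≤ 1) (hτ0 : τ ≤ E₀)
    (hE0 : 1 / 2 ≤ E₀)
    (hr : ∀ k, 1 / 2 ≤ ((1 - z k) * (1 - zb k)) ^ (shi - slo) ∧ 1 / 2 ≤ (z k * zb k) ^ (shi - slo))
    -- (O1), on `Q` itself
    (hI : ∀ p ∈ Q, 0 < pointFunctional w z zb (crossF p.1 (-1) (fun _ _ => (1 : ℝ))))
    -- head rows
    (t : ℕ → ℕ → ℝ) (K : ℕ → ℕ) (nF : ℕ → ℕ → ℕ) (hc : ℕ → ℕ → Bool)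
    (ht0 : t 0 0 = εlo ∧ t 0 (K 0) = E₀)
    (htℓ : ∀ ℓ, Even ℓ → ℓ ≠ 0 → ℓ < L → t ℓ 0 = (ℓ : ℝ) + 1 ∧ t ℓ (K ℓ) = E₀)
    (hlow : ∀ ℓ k, k < K ℓ → (ℓ : ℝ) + 1 ≤ t ℓ k)
    (hnF : ∀ ℓ k, k < K ℓ → E₀ ≤ t ℓ k + ((nF ℓ k : ℝ) + 1))
    (hρ : ∀ ℓ k, k < K ℓ → hc ℓ k = true → ∀ i, 1 / 2 ≤ (z i * zb i) ^ ((t ℓ (k + 1) - t ℓ k) / 2) ∧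
      1 / 2 ≤ ((1 - z i) * (1 - zb i)) ^ ((t ℓ (k + 1) - t ℓ k) / 2))
    (hhead : ∀ ℓ, (ℓ = 0 ∨ (Even ℓ ∧ ℓ < L)) → ∀ k < K ℓ,
      ∃ P : ℕ, ∃ σ : ℕ → ℝ, 0 < P ∧ σ 0 = slo ∧ σ P = shi ∧ (∀ i < P, σ i ≤ σ (i + 1)) ∧
        ∀ i < P, 0 ≤ headNumber w z zb ℓ (t ℓ k) (t ℓ (k + 1)) (σ i) (σ (i + 1)) (nF ℓ k) (hc ℓ k))
    -- (M) box rows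
    (e : ℕ → ℕ → ℝ) (M : ℕ → ℕ) (bc : ℕ → ℕ → Bool)
    (he : ∀ j : ℕ, (j : ℝ) + τ < ET → e j 0 ≤ max E₀ ((j : ℝ) + τ) ∧ ET ≤ e j (M j))
    (hρM : ∀ j m, m < M j → bc j m = true → ∀ k, 1 / 2 ≤ (z k * zb k) ^ ((e j (m + 1) - e j m) / 2) ∧
      1 / 2 ≤ ((1 - z k) * (1 - zb k)) ^ ((e j (m + 1) - e j m) / 2))
    (hbox : ∀ j : ℕ, (j : ℝ) + τ < ET → ∀ m < M j,
      0 ≤ boxNumber w z zb j (e j m) (e j (m + 1)) slo shi (bc j m))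
    -- (T)
    (hB : ∑ k ∈ univ.erase apex, |w k| * ((1 - z k) * (1 - zb k)) ^ slo * qd k ^ ET
          + ∑ k, |w k| * (z k * zb k) ^ slo * qr k ^ ET ≤
          w apex * ((1 - z apex) * (1 - zb apex)) ^ shi) :
    BoxExcluded Q := by
  have hQ1 : ∀ p ∈ Q, slo ≤ p.1 ∧ p.1 ≤ shi := fun p hp => (hQ p hp).1
  have hM := ruleM_of_boxTable_twist w z zb hz hzb τ hQ1 hr e M bc he hρM hbox
  -- every cell of every row (two-bit cell theorem with the monotone coefficient bit)
  have hcell : ∀ ℓ, (ℓ = 0 ∨ (Even ℓ ∧ ℓ < L)) → ∀ k < K ℓ, ∀ p ∈ Q,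
      ∀ Δ ∈ Ico (t ℓ k) (t ℓ (k + 1)), BlockPositive (pointFunctional w z zb) p.1 Δ ℓ := by
    intro ℓ hℓ k hk
    obtain ⟨P, σ, hP, hσ0, hσP, hmono, hnum⟩ := hhead ℓ hℓ k hk
    exact cell_of_headNumber₂_scover w z zb hz hzb hord apex hapex qd qr hqd hqr hdomd hdomr hQ1 hτ1
      hM hB hr (nF ℓ k) (hnF ℓ k hk) (hc ℓ k) false (fun _ => hlow ℓ k hk) (fun h => absurd h (by simp))
      (hρ ℓ k hk) σ P hP hσ0 hσP hmono
      (fun i hi => by simpa [headNumber₂] using hnum i hi)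
  have htail : ∀ p ∈ Q, ∀ ℓ : ℕ, ∀ Δ : ℝ, unitarityBound3D ℓ ≤ Δ → E₀ ≤ Δ →
      BlockPositive (pointFunctional w z zb) p.1 Δ ℓ := fun p hp ℓ Δ hbd hΔ0 =>
    tail_nonneg_pointFunctional_of_termwise_and_apex_twist w z zb hz hzb hord apex hapex qd qr hqd
      hqr hdomd hdomr hQ1 hτ1 hτ0 hM hB p hp ℓ Δ hbd hΔ0
  have hb0 : unitarityBound3D 0 = 1 / 2 := by simp [unitarityBound3D]
  exact SingleCorrelatorObligations.boxExcluded (Δstar := E₀) hz hzb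
    { identity_pos := hI
      epsilon_nonneg := fun p hp => by
        by_cases h : p.2 < E₀
        · exact blockPositive_of_cells_Ico (t 0) (K 0) (hcell 0 (Or.inl rfl)) p hp p.2
            ⟨ht0.1 ▸ (hQ p hp).2, ht0.2 ▸ h⟩
        · exact htail p hp 0 p.2 (by rw [hb0]; linarith [not_lt.1 h]) (not_lt.1 h)
      scalar_nonneg := scalar_nonneg_of_cells (t 0) (K 0) (ht0.1 ▸ hε3) ht0.2 (hcell 0 (Or.inl rfl))
      spinning_nonneg := spinning_nonneg_of_cells L hL t K
        (fun ℓ hev hℓ hℓL => (htℓ ℓ hev hℓ hℓL).1.le) (fun ℓ hev hℓ hℓL => (htℓ ℓ hev hℓ hℓL).2)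
        (fun ℓ hev hℓ hℓL => hcell ℓ (Or.inr ⟨hev, hℓL⟩))
      tail_nonneg := fun p hp ℓ _ Δ hbd hΔ0 => htail p hp ℓ Δ hbd hΔ0 }

namespace PointKernel

namespace PCert

variable {c : PCert}

/-! ### The per-cell fact, `s`-covered -/

/-- What an `s`-covered head cell `x = (e_a, e_b, n_F, bit)` of row `ℓ` delivers: SOME monotone
partition `slo = σ_0 ≤ ⋯ ≤ σ_P = shi` (`P ≥ 1`) with the cell's table number `≥ 0` on every piece
`[σ_i, σ_{i+1}]`, and for a chord cell the half conditions of its width. [folklore] -/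
def CellFactS (c : PCert) (ℓ : ℕ) (x : ℚ × ℚ × ℕ × Bool) : Prop :=
  (∃ P : ℕ, ∃ σ : ℕ → ℝ, 0 < P ∧ σ 0 = ((c.slo : ℚ) : ℝ) ∧ σ P = ((c.shi : ℚ) : ℝ) ∧
    (∀ i < P, σ i ≤ σ (i + 1)) ∧
    ∀ i < P, 0 ≤ headNumber c.wR c.zR c.zbR ℓ (((2 * x.1 : ℚ)) : ℝ) (((2 * x.2.1 : ℚ)) : ℝ)
      (σ i) (σ (i + 1)) x.2.2.1 x.2.2.2) ∧
  (x.2.2.2 = true → ∀ i : Fin c.N,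
    1 / 2 ≤ (c.zR i * c.zbR i) ^ (((((2 * x.2.1 : ℚ)) : ℝ) - (((2 * x.1 : ℚ)) : ℝ)) / 2) ∧
    1 / 2 ≤ ((1 - c.zR i) * (1 - c.zbR i)) ^ (((((2 * x.2.1 : ℚ)) : ℝ) - (((2 * x.1 : ℚ)) : ℝ)) / 2))

/-- A full-width cell fact is an `s`-covered one (`P = 1`; needs `slo ≤ shi`). [folklore] -/
theorem CellFact.toS (hle : c.slo ≤ c.shi) {ℓ : ℕ} {x : ℚ × ℚ × ℕ × Bool} (h : c.CellFact ℓ x) :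
    c.CellFactS ℓ x := by
  refine ⟨⟨1, fun i => if i = 0 then ((c.slo : ℚ) : ℝ) else ((c.shi : ℚ) : ℝ), Nat.one_pos,
    by simp, by simp, ?_, ?_⟩, h.2⟩
  · intro i hi
    have hi0 : i = 0 := by omega
    subst hi0
    have hle' : ((c.slo : ℚ) : ℝ) ≤ ((c.shi : ℚ) : ℝ) := by exact_mod_cast hle
    simpa using hle'
  · intro i hi
    have hi0 : i = 0 := by omega
    subst hi0
    simpa using h.1

/-- `CellFactS` for every cell of every segment from `CellFact` for every cell. [folklore] -/
theorem cellFactS_of_cellFact (hle : c.slo ≤ c.shi) (hsegs : List HSeg)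
    (hcells : ∀ i < hsegs.length, ∀ x ∈ segCells c.rho (segAt hsegs i), c.CellFact (segAt hsegs i).ell x) :
    ∀ i < hsegs.length, ∀ x ∈ segCells c.rho (segAt hsegs i), c.CellFactS (segAt hsegs i).ell x :=
  fun i hi x hx => (hcells i hi x hx).toS hle

/-! ### The kernel certificate theorem with `s`-covered cells -/

/-- **The kernel certificate theorem, (O1) in chord form, unbounded box, `s`-covered head cells.**
Exactly `boxExcluded_of_kernelC_unbounded` with the per-cell hypothesis weakened from `CellFact`
(number `≥ 0` on the full `s`-width) to `CellFactS` (numbers `≥ 0` on the pieces of some monotone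
partition of `[slo, shi]`).  CONCLUSION: `BoxExcluded (QBoxU slo shi εlo)`.
[cite: HogervorstRychkov2013, §3 eq. (3.6)] -/
theorem boxExcluded_of_kernelC_unboundedS (hc : c.checkNodes = true) (hside : c.sideOK = true)
    (tI : ℕ) (ho1 : c.o1OKC tI = true)
    (qd qr : List ℚ) (ET : ℕ) (hT : c.tOK qd qr ET = true)
    (εlo E0 τ : ℚ) (L J : ℕ) (hpar : paramOK εlo E0 τ L ET J = true) (hE0 : (1 : ℚ) / 2 ≤ E0)
    (hsegs : List HSeg) (hmetaH : hMetaOK c.rho hsegs εlo E0 L = true)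
    (mrows : List MRow) (hmetaM : c.mMetaOK mrows E0 τ ET J = true)
    (hcells : ∀ i < hsegs.length, ∀ x ∈ segCells c.rho (segAt hsegs i), c.CellFactS (segAt hsegs i).ell x)
    (hboxes : ∀ j < J, ∀ m < (rowAt mrows j).steps.length,
      0 ≤ termCornerBound c.wR c.zR c.zbR j (c.eM mrows j m) (c.eM mrows j (m + 1))
        ((c.slo : ℚ) : ℝ) ((c.shi : ℚ) : ℝ)) :
    BoxExcluded (QBoxU c.slo c.shi εlo) := by
  simp only [paramOK, Bool.and_eq_true, decide_eq_true_eq] at hpar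
  obtain ⟨⟨⟨⟨⟨hε3, hL⟩, hτ1⟩, hτ0⟩, hJ⟩, hL0⟩ := hpar
  obtain ⟨hqd, hqr, hdomd, hdomr, hB⟩ := t_hyps hc qd qr ET hT
  obtain ⟨ht0, htℓ, hlow, hnF, hcell⟩ := head_hyps c.rho hsegs εlo E0 L hmetaH
  -- the facts of cell `k` of row `ℓ`
  have hF : ∀ ℓ k, k < KH c.rho hsegs ℓ → c.CellFactS ℓ (cellAt c.rho hsegs ℓ k) := by
    intro ℓ k hk
    obtain ⟨-, -, i, hi, hell, hmem⟩ := hcell ℓ k hk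
    have := hcells i hi _ hmem
    rwa [hell] at this
  have hhead : ∀ ℓ, (ℓ = 0 ∨ (Even ℓ ∧ ℓ < L)) → ∀ k < KH c.rho hsegs ℓ,
      ∃ P : ℕ, ∃ σ : ℕ → ℝ, 0 < P ∧ σ 0 = ((c.slo : ℚ) : ℝ) ∧ σ P = ((c.shi : ℚ) : ℝ) ∧
        (∀ i < P, σ i ≤ σ (i + 1)) ∧
        ∀ i < P, 0 ≤ headNumber c.wR c.zR c.zbR ℓ (tH c.rho hsegs ℓ k) (tH c.rho hsegs ℓ (k + 1))
          (σ i) (σ (i + 1)) (nFH c.rho hsegs ℓ k) (bH c.rho hsegs ℓ k) := by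
    intro ℓ _ k hk
    obtain ⟨e1, e2, -⟩ := hcell ℓ k hk
    obtain ⟨⟨P, σ, hP, hσ0, hσP, hmono, hnum⟩, -⟩ := hF ℓ k hk
    refine ⟨P, σ, hP, hσ0, hσP, hmono, fun i hi => ?_⟩
    rw [e1, e2, nFH, bH]
    exact hnum i hi
  have hρ : ∀ ℓ k, k < KH c.rho hsegs ℓ → bH c.rho hsegs ℓ k = true → ∀ i : Fin c.N,
      1 / 2 ≤ (c.zR i * c.zbR i) ^ ((tH c.rho hsegs ℓ (k + 1) - tH c.rho hsegs ℓ k) / 2) ∧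
      1 / 2 ≤ ((1 - c.zR i) * (1 - c.zbR i)) ^ ((tH c.rho hsegs ℓ (k + 1) - tH c.rho hsegs ℓ k) / 2) := by
    intro ℓ k hk hb i
    obtain ⟨e1, e2, -⟩ := hcell ℓ k hk
    rw [e1, e2]
    exact (hF ℓ k hk).2 hb i
  have hJR : ((ET : ℕ) : ℝ) ≤ (J : ℝ) + ((τ : ℚ) : ℝ) := by
    have : (((ET : ℚ)) : ℝ) ≤ (((J : ℚ) + τ : ℚ) : ℝ) := by exact_mod_cast hJ
    push_cast at this; exact this
  obtain ⟨he, hρM, hbox⟩ := ruleM_hyps mrows E0 τ ET J hJR hmetaM hboxes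
  refine boxExcluded_of_pointTable_twist_unboundedS (w := c.wR) (z := c.zR) (zb := c.zbR)
    (slo := ((c.slo : ℚ) : ℝ)) (shi := ((c.shi : ℚ) : ℝ)) (εlo := ((εlo : ℚ) : ℝ)) (E₀ := ((E0 : ℚ) : ℝ))
    (ET := ((ET : ℕ) : ℝ)) (τ := ((τ : ℚ) : ℝ))
    (zR_mem hc) (zbR_mem hc) ?_ ⟨c.apex, apex_lt hc⟩ ?_ (c.qR qd) (c.qR qr) hqd hqr hdomd hdomr
    (fun p hp => hp) (by exact_mod_cast hε3) L (by exact_mod_cast hL) (by exact_mod_cast hτ1)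
    (by exact_mod_cast hτ0)
    (by have h := (Rat.cast_le (K := ℝ)).2 hE0; push_cast at h; linarith) (side_hyp hside)
    (fun p hp => o1C_hyp hc hside tI ho1 hp.1)
    (tH c.rho hsegs) (KH c.rho hsegs) (nFH c.rho hsegs) (bH c.rho hsegs) ht0 htℓ hlow hnF
    hρ hhead (c.eM mrows) (fun j => (rowAt mrows j).steps.length)
    (fun _ _ => false) he hρM hbox hB
  · intro k
    have hn := checkNode_of_checkNodes hc k.2
    simpa [zR, zbR] using (show ((c.zb k : ℚ) : ℝ) ≤ ((c.z k : ℚ) : ℝ) by exact_mod_cast zb_le_z hn)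
  · simpa [wR] using (show ((0 : ℚ) : ℝ) ≤ ((c.w c.apex : ℚ) : ℝ) by exact_mod_cast w_apex_nonneg hc)

/-! ### Piece certificates -/

/-- The certificate `c` with its `s`-box replaced by `[slo', shi']`; `a, b, d` are the indices, in the
SAME atom tables, of the exponents `slo'`, `shi'`, `shi' - slo'`.  Nodes, weights, scale and atoms are
shared, so every checker of the kernel runs on it unchanged. [folklore] -/
def withS (c : PCert) (slo' shi' : ℚ) (a b d : ℕ) : PCert :=
  { c with slo := slo', shi := shi', tslo := a, tshi := b, tdel := d }

section withS

variable (c : PCert) (slo' shi' : ℚ) (a b d : ℕ)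

/-- `withS` leaves `S` unchanged (or sets it). [folklore] -/
@[simp] theorem withS_S : (c.withS slo' shi' a b d).S = c.S := rfl
/-- `withS` leaves `nodes` unchanged (or sets it). [folklore] -/
@[simp] theorem withS_nodes : (c.withS slo' shi' a b d).nodes = c.nodes := rfl
/-- `withS` leaves `apex` unchanged (or sets it). [folklore] -/
@[simp] theorem withS_apex : (c.withS slo' shi' a b d).apex = c.apex := rfl
/-- `withS` leaves `slo` unchanged (or sets it). [folklore] -/
@[simp] theorem withS_slo : (c.withS slo' shi' a b d).slo = slo' := rfl
/-- `withS` leaves `shi` unchanged (or sets it). [folklore] -/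
@[simp] theorem withS_shi : (c.withS slo' shi' a b d).shi = shi' := rfl
/-- `withS` leaves `rho` unchanged (or sets it). [folklore] -/
@[simp] theorem withS_rho : (c.withS slo' shi' a b d).rho = c.rho := rfl
/-- `withS` leaves `atomsU` unchanged (or sets it). [folklore] -/
@[simp] theorem withS_atomsU : (c.withS slo' shi' a b d).atomsU = c.atomsU := rfl
/-- `withS` leaves `atomsV` unchanged (or sets it). [folklore] -/
@[simp] theorem withS_atomsV : (c.withS slo' shi' a b d).atomsV = c.atomsV := rfl
/-- `withS` leaves `tslo` unchanged (or sets it). [folklore] -/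
@[simp] theorem withS_tslo : (c.withS slo' shi' a b d).tslo = a := rfl
/-- `withS` leaves `tshi` unchanged (or sets it). [folklore] -/
@[simp] theorem withS_tshi : (c.withS slo' shi' a b d).tshi = b := rfl
/-- `withS` leaves `tdel` unchanged (or sets it). [folklore] -/
@[simp] theorem withS_tdel : (c.withS slo' shi' a b d).tdel = d := rfl
/-- `withS` leaves `N` unchanged (or sets it). [folklore] -/
@[simp] theorem withS_N : (c.withS slo' shi' a b d).N = c.N := rfl
/-- `withS` leaves `nd` unchanged (or sets it). [folklore] -/
@[simp] theorem withS_nd : (c.withS slo' shi' a b d).nd = c.nd := rfl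
/-- `withS` leaves `z` unchanged (or sets it). [folklore] -/
@[simp] theorem withS_z : (c.withS slo' shi' a b d).z = c.z := rfl
/-- `withS` leaves `zb` unchanged (or sets it). [folklore] -/
@[simp] theorem withS_zb : (c.withS slo' shi' a b d).zb = c.zb := rfl
/-- `withS` leaves `w` unchanged (or sets it). [folklore] -/
@[simp] theorem withS_w : (c.withS slo' shi' a b d).w = c.w := rfl
/-- `withS` leaves `u` unchanged (or sets it). [folklore] -/
@[simp] theorem withS_u : (c.withS slo' shi' a b d).u = c.u := rfl
/-- `withS` leaves `v` unchanged (or sets it). [folklore] -/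
@[simp] theorem withS_v : (c.withS slo' shi' a b d).v = c.v := rfl
/-- `withS` leaves `checkNode` unchanged (or sets it). [folklore] -/
@[simp] theorem withS_checkNode : (c.withS slo' shi' a b d).checkNode = c.checkNode := rfl
/-- `withS` leaves `zR` unchanged (or sets it). [folklore] -/
theorem withS_zR : (c.withS slo' shi' a b d).zR = c.zR := rfl
/-- `withS` leaves `zbR` unchanged (or sets it). [folklore] -/
theorem withS_zbR : (c.withS slo' shi' a b d).zbR = c.zbR := rfl
/-- `withS` leaves `wR` unchanged (or sets it). [folklore] -/
theorem withS_wR : (c.withS slo' shi' a b d).wR = c.wR := rfl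

end withS

/-- **Node checks of a piece certificate** = those of `c` plus the three (decidable) atom-index
identities for the new exponents. [folklore] -/
theorem checkNodes_withS (hc : c.checkNodes = true) {slo' shi' : ℚ} {a b d : ℕ}
    (ha : atomExp c.rho a = slo') (hb : atomExp c.rho b = shi') (hd : atomExp c.rho d = shi' - slo') :
    (c.withS slo' shi' a b d).checkNodes = true := by
  have hc' := hc
  simp only [checkNodes, Bool.and_eq_true, decide_eq_true_eq] at hc' ⊢
  obtain ⟨⟨⟨⟨⟨⟨hS, hall⟩, -⟩, -⟩, hapex⟩, hw⟩, -⟩ := hc'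
  exact ⟨⟨⟨⟨⟨⟨hS, hall⟩, ha⟩, hb⟩, hapex⟩, hw⟩, hd⟩

/-- The cell fact of a piece certificate is the cell's number on the piece `[slo', shi']` (same
nodes and weights). [folklore] -/
theorem CellFact_withS {slo' shi' : ℚ} {a b d : ℕ} {ℓ : ℕ} {x : ℚ × ℚ × ℕ × Bool}
    (h : (c.withS slo' shi' a b d).CellFact ℓ x) :
    0 ≤ headNumber c.wR c.zR c.zbR ℓ (((2 * x.1 : ℚ)) : ℝ) (((2 * x.2.1 : ℚ)) : ℝ) ((slo' : ℚ) : ℝ)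
        ((shi' : ℚ) : ℝ) x.2.2.1 x.2.2.2 ∧
    (x.2.2.2 = true → ∀ i : Fin c.N,
      1 / 2 ≤ (c.zR i * c.zbR i) ^ (((((2 * x.2.1 : ℚ)) : ℝ) - (((2 * x.1 : ℚ)) : ℝ)) / 2) ∧
      1 / 2 ≤ ((1 - c.zR i) * (1 - c.zbR i)) ^ (((((2 * x.2.1 : ℚ)) : ℝ) - (((2 * x.1 : ℚ)) : ℝ)) / 2)) :=
  h

/-- **Assembling the pieces.** A monotone rational partition `slo = σ_0 ≤ ⋯ ≤ σ_P = shi`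
(`P ≥ 1`) and, for every piece, the cell fact of the piece certificate
`c.withS (σ i) (σ (i+1)) …` give the `s`-covered cell fact of `c`. [folklore] -/
theorem CellFactS_of_pieces {ℓ : ℕ} {x : ℚ × ℚ × ℕ × Bool} (P : ℕ) (σ : ℕ → ℚ) (ia ib idl : ℕ → ℕ)
    (hP : 0 < P) (h0 : σ 0 = c.slo) (hP' : σ P = c.shi) (hmono : ∀ i < P, σ i ≤ σ (i + 1))
    (hf : ∀ i < P, (c.withS (σ i) (σ (i + 1)) (ia i) (ib i) (idl i)).CellFact ℓ x) :
    c.CellFactS ℓ x := by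
  refine ⟨⟨P, fun i => ((σ i : ℚ) : ℝ), hP, by simp [h0], by simp [hP'], fun i hi => ?_, fun i hi => ?_⟩, ?_⟩
  · show ((σ i : ℚ) : ℝ) ≤ ((σ (i + 1) : ℚ) : ℝ)
    exact_mod_cast hmono i hi
  · exact (CellFact_withS (hf i hi)).1
  · exact (CellFact_withS (hf 0 hP)).2

end PCert

end PointKernel

end Literature.MathematicalPhysics.QuantumFieldTheory.ConformalBootstrap3D
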